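import Summits.SmoothPoincare4.SmoothPoincare4.Theorems.SymplecticOrigamiGromovRecognitionRelEndHelperNormalVelocityChartData
import Summits.SmoothPoincare4.SmoothPoincare4.Theorems.SymplecticOrigamiGromovRecognitionRelEndHelperLinearisedNormalDichotomyFlat

/-!
# The normal velocity of a family of `J`-curves: local dichotomy at a zero (manifold form)
(registered helper `helper_normalVelocityLocal` of line `cross-cap-laurent`, crux `GromovRecognitionRelEnd`,
item stmt-SmoothPoincare4-11009; local half of the child stub `stub_normalVelocityDichotomy` of the split
piece `LocalFoliationEmbeddedSpheres`, item stmt-SmoothPoincare4-16778)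

Setting (Wendl 2018, proof of Prop. 2.53): `X` a `4`-manifold with almost complex structure `JX`;
`W a : ℂ → X`, `‖a‖ < ε`, a jointly smooth family of `JX`-holomorphic curves with `W 0 = w₀` smooth,
`JX`-holomorphic and immersed at `z₁`; `πN` smooth on an open `N`, vanishing along `w₀` near `z₁`,
`dπN` onto at `w₀ z₁`; normal velocity `σ z = (fderiv ℝ (fun a => πN (W a z)) 0) c`.

Claim (`helper_normalVelocityLocal`): if `σ z₁ = 0` then EITHER `σ ≡ 0` near `z₁`, OR `z₁` is an
isolated zero of `σ` of SIGNED index: for a sign `s = ±1` — the orientation sign of `dπN` relative to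
`JX` at `w₀ z₁`, `0 < s · Im (dπN (JX V) · conj (dπN V))` for all `V ∉ ker dπN` — and all small `r`,
`0 < s · wind (σ ∘ circleLoop z₁ r)`.  Proof: the chart data of `helper_normalVelocityChartData` feed
the flat dichotomy `helper_linearisedNormalDichotomyFlat` verbatim; its conclusion about
`z ↦ dψ_{b z} (ξ z) = σ (z + z₁)` is translated back with the dictionary `dψ ∘ dφ = dπN`,
`dψ ∘ Jg ∘ dφ = dπN ∘ JX` and `circleLoop z₁ r t = circleLoop 0 r t + z₁`.

References: C. Wendl, *Holomorphic Curves in Low Dimensions*, LNM 2216 (2018), Prop. 2.53 and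
§2.4–2.5.  No new definitions, notation or instances.
-/

noncomputable section

open scoped Manifold ContDiff Topology
open Set Function Filter Metric Literature.Geometry.Symplectic Literature.Topology.PlaneTopology

-- the prescribed namespace `Summit.<P>.<Sub>.…` duplicates `SmoothPoincare4` (P = Sub)
set_option linter.dupNamespace false

namespace Summit.SmoothPoincare4.SmoothPoincare4.Theorems.GromovRecognitionRelEnd.CrossCapLaurent

/-- The circle about `z₁` is the translate of the circle about `0`. [folklore] -/
theorem NormalVelocityLocal.circleLoop_eq_add (z₁ : ℂ) (r t : ℝ) :
    circleLoop z₁ r t = circleLoop 0 r t + z₁ := by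
  have h := circleLoop_sub z₁ z₁ r t
  rw [sub_self] at h
  rw [← h, sub_add_cancel]

open NormalVelocityLocal in
/-- **Registered helper `helper_normalVelocityLocal`** (see the module docstring): the local signed
dichotomy at a zero of the normal velocity of a family of `JX`-holomorphic curves, manifold form.
[cite: Wendl2018, Prop. 2.53 and §2.4–2.5] -/
theorem helper_normalVelocityLocal : ∀ (X : Type) [TopologicalSpace X] [T2Space X] [SecondCountableTopology X] [ChartedSpace (EuclideanSpace ℝ (Fin 4)) X] [IsManifold (𝓡 4) ∞ X] (JX : Literature.Geometry.Symplectic.AlmostComplexStructure (𝓡 4) ∞ X) (W : ℂ → ℂ → X) (w₀ : ℂ → X) (N : Set X) (πN : X → ℂ) (ε : ℝ) (z₁ c : ℂ), 0 < ε → IsOpen N → ContMDiffOn (𝓡 4) 𝓘(ℝ, ℂ) ∞ πN N → ContMDiff 𝓘(ℝ, ℂ) (𝓡 4) ∞ w₀ → Literature.Geometry.Symplectic.IsJHolomorphic (𝓡 4) (fun y => JX y) w₀ → Function.Injective (mfderiv 𝓘(ℝ, ℂ) (𝓡 4) w₀ z₁) → (∀ᶠ z in 𝓝 z₁, w₀ z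 ∈ N ∧ πN (w₀ z) = 0) → Function.Surjective (mfderiv (𝓡 4) 𝓘(ℝ, ℂ) πN (w₀ z₁)) → (∀ z : ℂ, W 0 z = w₀ z) → (∀ a : ℂ, ‖a‖ < ε → Literature.Geometry.Symplectic.IsJHolomorphic (𝓡 4) (fun y => JX y) (W a)) → ContMDiffOn 𝓘(ℝ, ℂ × ℂ) (𝓡 4) ∞ (fun q : ℂ × ℂ => W q.1 q.2) (Metric.ball 0 ε ×ˢ Set.univ) → fderiv ℝ (fun a : ℂ => πN (W a z₁)) 0 c = 0 → (∀ᶠ z in 𝓝 z₁, fderiv ℝ (fun a : ℂ => πN (W a z)) 0 c = 0) ∨ ∃ (s : ℤ) (r₀ : ℝ), (s = 1 ∨ s = -1) ∧ 0 < r₀ ∧ (∀ V : TangentSpace (𝓡 4) (w₀ z₁), mfderiv (𝓡 4) 𝓘(ℝ, ℂ) πN (w₀ z₁) V ≠ 0 → 0 < (s : ℝ) * ((show ℂ from mfderiv (𝓡 4) 𝓘(ℝ, ℂ) πN (w₀ z₁) (JX (w₀ z₁) V)) * (starRingEnd ℂ) (show ℂ from mfderiv (𝓡 4) 𝓘(ℝ,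 ℂ) πN (w₀ z₁) V)).im) ∧ (∀ z : ℂ, 0 < ‖z - z₁‖ → ‖z - z₁‖ ≤ r₀ → fderiv ℝ (fun a : ℂ => πN (W a z)) 0 c ≠ 0) ∧ (∀ r : ℝ, 0 < r → r ≤ r₀ → 0 < (s : ℤ) * Literature.Topology.PlaneTopology.wind (fun t : ℝ => fderiv ℝ (fun a : ℂ => πN (W a (Literature.Topology.PlaneTopology.circleLoop z₁ r t))) 0 c)) := by
  intro X _ _ _ _ _ JX W w₀ N πN ε z₁ c hε hN hπ hw₀ hJw₀ hinj hzero hsurj hW0 hJW hW h0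
  obtain ⟨Jg, b, ξ, ψ, T, R, hJg, hb, hR, hbinj, hbJ, hJ2, htan, hξ, hlin, hTo, hb0T, hψ, hψb, hψsurj,
    htrans, hdict⟩ := helper_normalVelocityChartData X JX W w₀ N πN ε z₁ c hε hN hπ hw₀ hJw₀ hinj hzero
      hsurj hW0 hJW hW
  -- the flat zero at `0`
  have h0' : fderiv ℝ ψ (b 0) (ξ 0) = 0 := by
    rw [← htrans 0 (mem_ball_self hR), zero_add]
    exact h0
  have hfin : Module.finrank ℝ (EuclideanSpace ℝ (Fin 4)) = 4 := finrank_euclideanSpace_fin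
  rcases helper_linearisedNormalDichotomyFlat (EuclideanSpace ℝ (Fin 4)) hfin Jg b ξ ψ T R hJg hb hR
      hbinj hbJ hJ2 htan hξ hlin hTo hb0T hψ hψb hψsurj h0' with hflat | ⟨s, r₀, hs, hr₀, hsign, hne, hwind⟩
  · -- `σ ≡ 0` near `z₁`
    left
    obtain ⟨r, hr, hrb⟩ := Metric.eventually_nhds_iff_ball.1
      (hflat.and (eventually_mem_nhds_iff.2 (ball_mem_nhds (0 : ℂ) hR)) |>.mono fun z hz => hz)
    rw [Metric.eventually_nhds_iff_ball]
    refine ⟨r, hr, fun y hy => ?_⟩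
    have hy' : y - z₁ ∈ ball (0 : ℂ) r := by
      rw [mem_ball, dist_zero_right]; rwa [mem_ball, dist_eq_norm] at hy
    obtain ⟨h1, h2⟩ := hrb (y - z₁) hy'
    have h3 := htrans (y - z₁) (mem_of_mem_nhds h2)
    rw [sub_add_cancel] at h3
    rw [h3]
    exact h1
  · right
    set r₁ : ℝ := min r₀ (R / 2) with hr₁_def
    have hr₁ : 0 < r₁ := lt_min hr₀ (by positivity)
    have hr₁R : ∀ z : ℂ, ‖z‖ ≤ r₁ → z ∈ ball (0 : ℂ) R := fun z hz => by
      rw [mem_ball, dist_zero_right]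
      exact lt_of_le_of_lt (hz.trans (min_le_right _ _)) (by linarith)
    refine ⟨s, r₁, hs, hr₁, fun V hV => ?_, fun z hz0 hzr => ?_, fun r hr hrr₁ => ?_⟩
    · -- the sign clause through the dictionary
      obtain ⟨h1, h2⟩ := hdict V
      have hV' : fderiv ℝ ψ (b 0)
          (mfderiv (𝓡 4) 𝓘(ℝ, EuclideanSpace ℝ (Fin 4)) (extChartAt (𝓡 4) (w₀ z₁)) (w₀ z₁) V) ≠ 0 := by
        rw [h1]; exact hV
      have := hsign _ hV'
      rwa [h1, h2] at this
    · -- zeros in the punctured disc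
      have hz1 : ‖z - z₁‖ ≤ r₀ := hzr.trans (min_le_left _ _)
      have h3 := htrans (z - z₁) (hr₁R _ hzr)
      rw [sub_add_cancel] at h3
      rw [h3]
      exact hne (z - z₁) hz0 hz1
    · -- winding numbers on small circles
      have hloop : (fun t : ℝ => fderiv ℝ (fun a : ℂ => πN (W a (circleLoop z₁ r t))) 0 c) =
          fun t : ℝ => fderiv ℝ ψ (b (circleLoop 0 r t)) (ξ (circleLoop 0 r t)) := by
        funext t
        rw [circleLoop_eq_add z₁ r t]
        apply htrans
        apply hr₁R
        have : ‖circleLoop 0 r t‖ = r := by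
          simpa [abs_of_pos hr] using norm_circleLoop_sub_center 0 r t
        rw [this]
        exact hrr₁
      rw [hloop]
      exact hwind r hr (hrr₁.trans (min_le_left _ _))

end Summit.SmoothPoincare4.SmoothPoincare4.Theorems.GromovRecognitionRelEnd.CrossCapLaurent

end
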